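import Literature.AnabelianGeometry.AbsoluteAnabelian.AbsTopII.InertiaGroupsCuspScope
import Literature.AnabelianGeometry.AbsoluteAnabelian.AbsTopII.InertiaDecompositionBranch

/-!
# [AbsTopII] Prop 1.3 (iii) with the printed conjugacy scope: `Prop_1_3_iii'' → Prop_1_3_iii'` and the closers re-keyed

S. Mochizuki, *Topics in Absolute Anabelian Geometry II* [AbsTopII] (bib `MochizukiAbsTopII2013`;
locators = PDF pages of the kurims manuscript `paper:url-585b8d0ad0d9`), §1, Def 1.2 (ii) p. 10,
Prop 1.3 (iii) p. 11, proof p. 13 ("Now suppose that `e` is a cusp that abuts to `v`. Then [for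
appropriate choices of conjugates] it follows immediately from the definitions that we have inclusions
`I_e, I_v ⊆ D_e ∩ Π_I`, and that `I_e` commutes with `I_v`. …").

PROOF-ONLY companion (no definition) of `AbsTopII/InertiaGroupsCuspScope.lean` (abc-iut-L4-t6 lineage,
row «P13iii-SCOPE»):
* `prop_1_3_iii'_of_prop_1_3_iii''` — the printed `Π_𝔾`-scope form implies the v1 `Π_H`-scope form
  `Prop_1_3_iii'` (p405221; FACT-LIST F-0299), so every consumer of the v1 predicate is served by v2;
* `prop_1_3_iii''_of_inputs` — this lineage's `prop_1_3_iii'_of_inputs` (p427149) with the cusp input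
  "an appropriate conjugate of `I_v` in `D_e ∩ Π_I` commuting with `I_e`" asked of a `Π_𝔾`-conjugate;
* `prop_1_3_iii''_of_branch` — abc-iut-f-069's `prop_1_3_iii'_of_branch` re-keyed: the cusp input
  DISCHARGED from the `Π_𝔾`-level branch inclusion `Π_e ⊆ γ·Π_{v(e)}·γ⁻¹`, `γ ∈ Π_𝔾` ([CombGC] Def 1.1
  (ii); exactly the output shape of `DPSCData.cuspSub_le_conj_vertSub_ofEmbedding`), and
  `prop_1_3_iii''_of_branch_le` — the case of compatibly chosen representatives `Π_e ⊆ Π_{v(e)}`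
  (`γ = 1`; e.g. the smooth-curve shape `Π_v = Π_𝔾`);
* `prop_1_3_iii''_iff_prop_1_3_iii'_of_isEmpty` — with no cusps the two forms coincide (so the
  procyclic non-vacuity model of `AbsTopII/Prop13ProcyclicModel.lean` serves both).
Remaining printed inputs stay hypotheses, as in the v1 closers: [CombGC] Prop 1.2 (ii) for `Π_v`, `Π_e`,
slimness of `Π_v` ([CombGC] Rmk 1.1.3), "`I_v ↠ I`", "`I_v ≅ Ẑ^Σ`".  HONEST FRAMING: classical group
theory over abstract DPSC data; typed ≠ proved; nothing here bears on [IUTchIII] Cor 3.12.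
-/

open scoped Pointwise

universe u

namespace Literature.AnabelianGeometry.AbsoluteAnabelian.AbsTopII.DPSCIndexData

open Literature.AlgebraicGeometry.Frobenioids (IsSlimGroup)

variable (X : DPSCIndexData.{u})

/-- **`Prop_1_3_iii'' → Prop_1_3_iii'`**: the printed `Π_𝔾`-conjugacy scope implies the v1 typing, whose
cusp clause allows any `Π_H`-conjugate of `I_v` (restriction of the witness `γ ∈ Π_𝔾 ⊆ Π_H`).
[cite: MochizukiAbsTopII2013, Prop 1.3 (iii) p.11] -/
theorem prop_1_3_iii'_of_prop_1_3_iii'' (h : X.Prop_1_3_iii'') : X.Prop_1_3_iii' :=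
  ⟨h.1, fun e => by
    obtain ⟨γ, -, hγ⟩ := h.2 e
    exact ⟨γ, hγ⟩⟩

/-- With NO cusps the cusp clauses are vacuous: `Prop_1_3_iii'' ↔ Prop_1_3_iii'` (both reduce to the
vertex clauses "`D_v ∩ Π_I = I_v × Π_v`, `I_v ≅ Ẑ^Σ`"). [cite: MochizukiAbsTopII2013, Prop 1.3 (iii) p.11] -/
theorem prop_1_3_iii''_iff_prop_1_3_iii'_of_isEmpty [IsEmpty X.Cusp] :
    X.Prop_1_3_iii'' ↔ X.Prop_1_3_iii' :=
  ⟨X.prop_1_3_iii'_of_prop_1_3_iii'', fun h => ⟨h.1, fun e => isEmptyElim e⟩⟩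

/-- **[AbsTopII] Prop 1.3 (iii) (rest), PRINTED SCOPE (`Prop_1_3_iii''`), from its printed inputs**: the
internal products `D_v ∩ Π_I = I_v × Π_v` and `D_e ∩ Π_I = I_e × γ·I_v·γ⁻¹` and the exactness clauses
PROVED (pure group theory: this lineage's `isInternalProduct_Iv_vertSub`, `isInternalProduct_IvCusp`);
hypotheses = [CombGC] Prop 1.2 (ii) for `Π_v`, `Π_e`, slimness of `Π_v`, "`I_v · Π_𝔾 = Π_I`",
"`I_v ≅ Ẑ^Σ`", and for each cusp a `Π_𝔾`-CONJUGATE `γ·I_{v(e)}·γ⁻¹ ⊆ D_e ∩ Π_I` commuting with `I_e`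
("[for appropriate choices of conjugates] … immediately from the definitions", proof p. 13).
[cite: MochizukiAbsTopII2013, Prop 1.3 (iii) p.11] -/
theorem prop_1_3_iii''_of_inputs
    (hCTv : ∀ v : X.Vert, IsCommensurablyTerminal ((X.vertSub v).subgroupOf X.PiG))
    (hCTc : ∀ e : X.Cusp, IsCommensurablyTerminal ((X.cuspSub e).subgroupOf X.PiG))
    (hslim : ∀ v : X.Vert, IsSlimGroup ↥(X.vertSub v))
    (hsurj : ∀ v : X.Vert, X.Iv v ⊔ X.PiG = X.PiI)
    (hcyc : ∀ v : X.Vert, IsFreeProSigmaCyclic X.Sigma ↥(X.Iv v))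
    (hcusp : ∀ e : X.Cusp, ∃ γ : X.PiH, γ ∈ X.PiG ∧
      MulAut.conj γ • X.Iv (X.cuspVert e) ≤ X.DvCusp e ⊓ X.PiI ∧
      ∀ a ∈ X.IvCusp e, ∀ b ∈ MulAut.conj γ • X.Iv (X.cuspVert e), a * b = b * a) :
    X.Prop_1_3_iii'' := by
  refine ⟨fun v => ⟨X.toDPSCData.isInternalProduct_Iv_vertSub hCTv hslim hsurj v, hcyc v⟩,
    fun e => ?_⟩
  obtain ⟨γ, hγ, hle, hcomm⟩ := hcusp e
  exact ⟨γ, hγ, X.toDPSCData.isInternalProduct_IvCusp hCTc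
    (X.toDPSCData.prop13iii_of_inputs hCTv hslim hsurj) e γ hle hcomm⟩

/-- **`Prop_1_3_iii''` from the printed inputs, the cusp input DISCHARGED by the branch inclusion**
`Π_e ⊆ γ·Π_{v(e)}·γ⁻¹` with `γ ∈ Π_𝔾` ([CombGC] Def 1.1 (ii): the verticial branch of the cusp; the
centraliser is antitone, `DPSCData.cuspconj_of_cuspSub_le`) — abc-iut-f-069's `prop_1_3_iii'_of_branch`
with the printed conjugacy scope kept.  At embedded data the hypothesis `hbranch` is literally
`DPSCData.cuspSub_le_conj_vertSub_ofEmbedding`. [cite: MochizukiAbsTopII2013, Prop 1.3 (iii) proof p.13] -/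
theorem prop_1_3_iii''_of_branch
    (hCTv : ∀ v : X.Vert, IsCommensurablyTerminal ((X.vertSub v).subgroupOf X.PiG))
    (hCTc : ∀ e : X.Cusp, IsCommensurablyTerminal ((X.cuspSub e).subgroupOf X.PiG))
    (hslim : ∀ v : X.Vert, IsSlimGroup ↥(X.vertSub v))
    (hsurj : ∀ v : X.Vert, X.Iv v ⊔ X.PiG = X.PiI)
    (hcyc : ∀ v : X.Vert, IsFreeProSigmaCyclic X.Sigma ↥(X.Iv v))
    (hbranch : ∀ e : X.Cusp, ∃ γ : X.PiH, γ ∈ X.PiG ∧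
      X.cuspSub e ≤ MulAut.conj γ • X.vertSub (X.cuspVert e)) :
    X.Prop_1_3_iii'' :=
  X.prop_1_3_iii''_of_inputs hCTv hCTc hslim hsurj hcyc fun e => by
    obtain ⟨γ, hγ, h⟩ := hbranch e
    exact ⟨γ, hγ, X.toDPSCData.cuspconj_of_cuspSub_le h⟩

/-- **`Prop_1_3_iii''` for compatibly chosen representatives `Π_e ⊆ Π_{v(e)}`** (no conjugation needed:
`γ = 1 ∈ Π_𝔾`) — e.g. DPSC data of smooth-curve shape (one vertex, `Π_v = Π_𝔾`), where the hypothesis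
`hle` is `X.cuspSub_le`. [cite: MochizukiAbsTopII2013, Prop 1.3 (iii) proof p.13] -/
theorem prop_1_3_iii''_of_branch_le
    (hCTv : ∀ v : X.Vert, IsCommensurablyTerminal ((X.vertSub v).subgroupOf X.PiG))
    (hCTc : ∀ e : X.Cusp, IsCommensurablyTerminal ((X.cuspSub e).subgroupOf X.PiG))
    (hslim : ∀ v : X.Vert, IsSlimGroup ↥(X.vertSub v))
    (hsurj : ∀ v : X.Vert, X.Iv v ⊔ X.PiG = X.PiI)
    (hcyc : ∀ v : X.Vert, IsFreeProSigmaCyclic X.Sigma ↥(X.Iv v))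
    (hle : ∀ e : X.Cusp, X.cuspSub e ≤ X.vertSub (X.cuspVert e)) :
    X.Prop_1_3_iii'' :=
  X.prop_1_3_iii''_of_branch hCTv hCTc hslim hsurj hcyc fun e =>
    ⟨1, Subgroup.one_mem _, by rw [map_one, one_smul]; exact hle e⟩

/-- In particular, for DPSC data of SMOOTH-CURVE SHAPE — every verticial subgroup is all of `Π_𝔾` — the
branch hypothesis disappears: `Prop_1_3_iii''` from [CombGC] Prop 1.2 (ii), slimness, "`I_v ↠ I`" and
"`I_v ≅ Ẑ^Σ`" alone. [cite: MochizukiAbsTopII2013, Prop 1.3 (iii) proof p.13] -/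
theorem prop_1_3_iii''_of_vertSub_eq_PiG
    (hCTv : ∀ v : X.Vert, IsCommensurablyTerminal ((X.vertSub v).subgroupOf X.PiG))
    (hCTc : ∀ e : X.Cusp, IsCommensurablyTerminal ((X.cuspSub e).subgroupOf X.PiG))
    (hslim : ∀ v : X.Vert, IsSlimGroup ↥(X.vertSub v))
    (hsurj : ∀ v : X.Vert, X.Iv v ⊔ X.PiG = X.PiI)
    (hcyc : ∀ v : X.Vert, IsFreeProSigmaCyclic X.Sigma ↥(X.Iv v))
    (hsm : ∀ v : X.Vert, X.vertSub v = X.PiG) :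
    X.Prop_1_3_iii'' :=
  X.prop_1_3_iii''_of_branch_le hCTv hCTc hslim hsurj hcyc fun e => by
    rw [hsm]
    exact X.cuspSub_le e

/-- The v2 predicate recovers abc-iut-L4-t4's first clause `DPSCData.Prop13iii` ("`I_v ∩ Π_𝔾 = 1`,
`I_v · Π_𝔾 = Π_I`") at a vertex, granted `D_v ∩ Π_𝔾 = Π_v` (Prop 1.3 (v)) and "`I_v ↠ I`" — through
`Prop_1_3_iii'_inf_eq_bot` (consistency of the files' renderings, now for v2).
[cite: MochizukiAbsTopII2013, Prop 1.3 (iii) p.11] -/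
theorem Prop_1_3_iii''_inf_eq_bot (h : X.Prop_1_3_iii'') (v : X.Vert)
    (hv : X.Dv v ⊓ X.PiG = X.vertSub v) : X.Iv v ⊓ X.PiG = ⊥ :=
  X.Prop_1_3_iii'_inf_eq_bot (X.prop_1_3_iii'_of_prop_1_3_iii'' h) v hv

end Literature.AnabelianGeometry.AbsoluteAnabelian.AbsTopII.DPSCIndexData
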